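import Summits.Ventures.Crystal3D.Theorems.StickyWulffConstantCoaxialWallLawJammedFrames
import Summits.Ventures.Crystal3D.Theorems.StickyWulffConstantGenericWallFloorStarLemma
import HarnessLib

/-!
# HEAL-CAP: a ball whose basal hexagon and lower triple are occupied has at most two off-tip further contacts
# (crux `CoaxialWallLaw`, stmt-Ventures-19481; line `WallLedgerF`, skeleton 'CoaxialWallLawCertificates' v5; cf-p1 (ccxviii)/(ccxx) «HEAL-CAP»)

HONEST FRAMING. Venture `Summits/Ventures/Crystal3D` (cell `crystal3d-full`); an elementary cap-packing lemma for the crux `CoaxialWallLaw`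
(stmt-Ventures-19481, `route-Ventures-StickyWulffConstant`), line 'Certificates' v5, stub `stub_seamResidual` (the healing term `heal(b)` of
`…SeamSplit.pooledDef_exactOf_le` / the lowered pools of the exact skeleton).  Nothing about the stub is claimed; F-C1 not moved.
THE FACT (memo F-TAIL-g11 §5, checked numerically by calc/healcap2.py): let a unit direction `u` make inner product `≤ 1/2` with the six BASAL slots and the
three LOWER slots of the model dozen (this is `1`-separation of the contact `y + u` from the nine balls `y + slot`).  In cubic coordinates `x = cubicCoords u`
(model axis `(−1,1,1)/√3`) the constraints read `|x₀+x₁|, |x₀+x₂|, |x₁−x₂| ≤ 1/√2` and `x₀−x₁, x₀−x₂, −x₁−x₂ ≤ 1/√2`, and: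
* `HealCap.axis_ge` — the axial component is `≥ √(2/3)`: `−x₀+x₁+x₂ ≥ √2` (the hexagon of inradius `1/2` has circumradius `1/√3`; the lower cap is excluded
  by the lower triple);
* `HealCap.tip` — equality `−x₀+x₁+x₂ = √2` holds exactly at SIX TIPS: the three upper fcc slots and the three basal mirrors of the lower slots (hcp positions);
* `HealCap.three_axis` — three such directions pairwise at inner product `≤ 1/2` all have axial component exactly `√(2/3)` (sum/Cauchy–Schwarz), hence are tips;
* **`healFree_three`** (vector form) and **`card_offTip_contacts_le_two`**: in a `1`-separated configuration, a ball `y` whose nine positions `y + L(slot)`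
  (basal hexagon + lower triple of ANY frame `L`) are occupied has AT MOST TWO further contacts off the six tip positions `y + L(tip)`; `healTips_subset_module`:
  the tips are points of the coaxial module (so at most two further contacts are off-module — «facet balls heal to degree ≤ 11, never 12 off-module»).
WHAT THIS IS NOT: no statement about pools or the stub; F-C1 not moved.
-/

noncomputable section

namespace Summit.Ventures.Crystal3D.Theorems

namespace TailResidue

open Summit.Ventures.Crystal3D Finset NearIdentity
open Literature.MathematicalPhysics.StatisticalMechanics (basalMirror)
open scoped InnerProductSpace

namespace HealCap

/-! ### Real-variable core -/

/-- The quadratic form `α² + αγ + γ²` is `≤ c²` on the hexagon `|α|, |γ|, |α+γ| ≤ c`. -/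
theorem sq_form_le {α γ c : ℝ} (hα : |α| ≤ c) (hγ : |γ| ≤ c) (hβ : |α + γ| ≤ c) :
    α ^ 2 + α * γ + γ ^ 2 ≤ c ^ 2 := by
  obtain ⟨hα₁, hα₂⟩ := abs_le.1 hα
  obtain ⟨hγ₁, hγ₂⟩ := abs_le.1 hγ
  obtain ⟨hβ₁, hβ₂⟩ := abs_le.1 hβ
  have hβsq : (α + γ) ^ 2 ≤ c ^ 2 := by nlinarith
  have hαsq : α ^ 2 ≤ c ^ 2 := by nlinarith
  have hγsq : γ ^ 2 ≤ c ^ 2 := by nlinarith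
  rcases le_total 0 (α * γ) with h | h
  · nlinarith
  · rcases le_total (α ^ 2) (γ ^ 2) with h' | h'
    · nlinarith [sq_nonneg (α + γ), sq_nonneg (α - γ), mul_self_nonneg α]
    · nlinarith [sq_nonneg (α + γ), sq_nonneg (α - γ), mul_self_nonneg γ]

/-- Equality cases of `sq_form_le`: the six vertices of the hexagon. -/
theorem sq_form_eq_cases {α γ c : ℝ} (hc : 0 < c) (hα : |α| ≤ c) (hγ : |γ| ≤ c) (hβ : |α + γ| ≤ c)
    (heq : α ^ 2 + α * γ + γ ^ 2 = c ^ 2) :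
    (α = 0 ∧ γ = c) ∨ (α = 0 ∧ γ = -c) ∨ (γ = 0 ∧ α = c) ∨ (γ = 0 ∧ α = -c) ∨ (α = c ∧ γ = -c) ∨ (α = -c ∧ γ = c) := by
  obtain ⟨hα₁, hα₂⟩ := abs_le.1 hα
  obtain ⟨hγ₁, hγ₂⟩ := abs_le.1 hγ
  obtain ⟨hβ₁, hβ₂⟩ := abs_le.1 hβ
  have hβsq : (α + γ) ^ 2 ≤ c ^ 2 := by nlinarith
  have sq_c : ∀ {t : ℝ}, t ^ 2 = c ^ 2 → t = c ∨ t = -c := fun ht => sq_eq_sq_iff_eq_or_eq_neg.1 ht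
  by_cases h0 : α * γ = 0
  · rcases mul_eq_zero.1 h0 with hα0 | hγ0
    · subst hα0
      have : γ ^ 2 = c ^ 2 := by nlinarith
      rcases sq_c this with h | h
      · exact Or.inl ⟨rfl, h⟩
      · exact Or.inr (Or.inl ⟨rfl, h⟩)
    · subst hγ0
      have : α ^ 2 = c ^ 2 := by nlinarith
      rcases sq_c this with h | h
      · exact Or.inr (Or.inr (Or.inl ⟨rfl, h⟩))
      · exact Or.inr (Or.inr (Or.inr (Or.inl ⟨rfl, h⟩)))
  · rcases lt_or_gt_of_ne h0 with hneg | hpos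
    · rcases lt_or_gt_of_ne (left_ne_zero_of_mul h0) with hαn | hαp
      · have hγp : 0 < γ := by nlinarith
        rcases le_or_gt (α + γ) 0 with hs | hs
        · have h1 : α ^ 2 = c ^ 2 := by nlinarith
          have h2 : α = -c := by
            rcases sq_eq_sq_iff_eq_or_eq_neg.1 h1 with h | h
            · exact absurd h (by nlinarith)
            · exact h
          exact Or.inr (Or.inr (Or.inr (Or.inr (Or.inr ⟨h2, by nlinarith⟩))))
        · have h1 : γ ^ 2 = c ^ 2 := by nlinarith
          have h2 : γ = c := by
            rcases sq_eq_sq_iff_eq_or_eq_neg.1 h1 with h | h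
            · exact h
            · exact absurd h (by nlinarith)
          exact Or.inr (Or.inr (Or.inr (Or.inr (Or.inr ⟨by nlinarith, h2⟩))))
      · have hγn : γ < 0 := by nlinarith
        rcases le_or_gt 0 (α + γ) with hs | hs
        · have h1 : α ^ 2 = c ^ 2 := by nlinarith
          have h2 : α = c := by
            rcases sq_eq_sq_iff_eq_or_eq_neg.1 h1 with h | h
            · exact h
            · exact absurd h (by nlinarith)
          exact Or.inr (Or.inr (Or.inr (Or.inr (Or.inl ⟨h2, by nlinarith⟩))))
        · have h1 : γ ^ 2 = c ^ 2 := by nlinarith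
          have h2 : γ = -c := by
            rcases sq_eq_sq_iff_eq_or_eq_neg.1 h1 with h | h
            · exact absurd h (by nlinarith)
            · exact h
          exact Or.inr (Or.inr (Or.inr (Or.inr (Or.inl ⟨by nlinarith, h2⟩))))
    · exfalso; nlinarith

/-- **Axial component**: under the nine constraints a unit direction has `−x₀+x₁+x₂ ≥ 2c` (`c = 1/√2`, i.e. axial cosine `≥ √(2/3)`). -/
theorem axis_ge {x0 x1 x2 c : ℝ} (hc : c ^ 2 = 1 / 2) (hc0 : 0 < c) (hn : x0 ^ 2 + x1 ^ 2 + x2 ^ 2 = 1)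
    (h01 : |x0 + x1| ≤ c) (h02 : |x0 + x2| ≤ c) (h12 : |x1 - x2| ≤ c)
    (l1 : x0 - x1 ≤ c) (l2 : x0 - x2 ≤ c) (l3 : -x1 - x2 ≤ c) : 2 * c ≤ -x0 + x1 + x2 := by
  have h02' : |-(x0 + x2)| ≤ c := by rwa [abs_neg]
  have h12' : |(x0 + x1) + -(x0 + x2)| ≤ c := by
    have : (x0 + x1) + -(x0 + x2) = x1 - x2 := by ring
    rw [this]; exact h12
  have hq := sq_form_le h01 h02' h12'
  have hid : 2 * ((x0 + x1) ^ 2 + (x0 + x1) * -(x0 + x2) + (-(x0 + x2)) ^ 2) =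
      3 * (x0 ^ 2 + x1 ^ 2 + x2 ^ 2) - (-x0 + x1 + x2) ^ 2 := by ring
  have hT2 : 2 ≤ (-x0 + x1 + x2) ^ 2 := by nlinarith
  by_contra hlt
  push Not at hlt
  have hlow : 0 < -x0 + x1 + x2 + 2 * c := by linarith
  nlinarith [mul_pos (sub_pos.2 hlt) hlow]

/-- **The six tips**: equality `−x₀+x₁+x₂ = 2c` on the unit sphere under the hexagon constraints holds exactly at the three upper fcc slots
`(−c,c,0), (−c,0,c), (0,c,c)` and the three hcp positions `(−c/3,c/3,4c/3), (−c/3,4c/3,c/3), (−4c/3,c/3,c/3)`. -/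
theorem tip {x0 x1 x2 c : ℝ} (hc : c ^ 2 = 1 / 2) (hc0 : 0 < c) (hn : x0 ^ 2 + x1 ^ 2 + x2 ^ 2 = 1)
    (h01 : |x0 + x1| ≤ c) (h02 : |x0 + x2| ≤ c) (h12 : |x1 - x2| ≤ c) (hT : -x0 + x1 + x2 = 2 * c) :
    (x0 = -c ∧ x1 = c ∧ x2 = 0) ∨ (x0 = -c ∧ x1 = 0 ∧ x2 = c) ∨ (x0 = 0 ∧ x1 = c ∧ x2 = c) ∨
      (x0 = -c / 3 ∧ x1 = c / 3 ∧ x2 = 4 * c / 3) ∨ (x0 = -c / 3 ∧ x1 = 4 * c / 3 ∧ x2 = c / 3) ∨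
      (x0 = -(4 * c) / 3 ∧ x1 = c / 3 ∧ x2 = c / 3) := by
  have h02' : |-(x0 + x2)| ≤ c := by rwa [abs_neg]
  have h12' : |(x0 + x1) + -(x0 + x2)| ≤ c := by
    have : (x0 + x1) + -(x0 + x2) = x1 - x2 := by ring
    rw [this]; exact h12
  have hid : 2 * ((x0 + x1) ^ 2 + (x0 + x1) * -(x0 + x2) + (-(x0 + x2)) ^ 2) =
      3 * (x0 ^ 2 + x1 ^ 2 + x2 ^ 2) - (-x0 + x1 + x2) ^ 2 := by ring
  have heq : (x0 + x1) ^ 2 + (x0 + x1) * -(x0 + x2) + (-(x0 + x2)) ^ 2 = c ^ 2 := by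
    rw [hn, hT] at hid; nlinarith
  rcases sq_form_eq_cases hc0 h01 h02' h12' heq with ⟨ha, hg⟩ | ⟨ha, hg⟩ | ⟨hg, ha⟩ | ⟨hg, ha⟩ | ⟨ha, hg⟩ | ⟨ha, hg⟩
  · exact Or.inl ⟨by linarith, by linarith, by linarith⟩
  · exact Or.inr (Or.inr (Or.inr (Or.inl ⟨by linarith, by linarith, by linarith⟩)))
  · exact Or.inr (Or.inr (Or.inr (Or.inr (Or.inl ⟨by linarith, by linarith, by linarith⟩))))
  · exact Or.inr (Or.inl ⟨by linarith, by linarith, by linarith⟩)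
  · exact Or.inr (Or.inr (Or.inl ⟨by linarith, by linarith, by linarith⟩))
  · exact Or.inr (Or.inr (Or.inr (Or.inr (Or.inr ⟨by linarith, by linarith, by linarith⟩))))

/-- A Cauchy–Schwarz instance: `(−p+q+r)² ≤ 3(p²+q²+r²)`. -/
theorem axis_sq_le (p q r : ℝ) : (-p + q + r) ^ 2 ≤ 3 * (p ^ 2 + q ^ 2 + r ^ 2) := by
  nlinarith [sq_nonneg (p + q), sq_nonneg (p + r), sq_nonneg (q - r)]

/-- **Three directions**: unit directions with axial components `≥ 2c` pairwise at inner product `≤ 1/2` all have axial component exactly `2c`. -/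
theorem three_axis {c : ℝ} (hc : c ^ 2 = 1 / 2) (hc0 : 0 < c) {a0 a1 a2 b0 b1 b2 d0 d1 d2 : ℝ}
    (ha : a0 ^ 2 + a1 ^ 2 + a2 ^ 2 = 1) (hb : b0 ^ 2 + b1 ^ 2 + b2 ^ 2 = 1) (hd : d0 ^ 2 + d1 ^ 2 + d2 ^ 2 = 1)
    (hTa : 2 * c ≤ -a0 + a1 + a2) (hTb : 2 * c ≤ -b0 + b1 + b2) (hTd : 2 * c ≤ -d0 + d1 + d2)
    (hab : a0 * b0 + a1 * b1 + a2 * b2 ≤ 1 / 2) (had : a0 * d0 + a1 * d1 + a2 * d2 ≤ 1 / 2)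
    (hbd : b0 * d0 + b1 * d1 + b2 * d2 ≤ 1 / 2) :
    -a0 + a1 + a2 = 2 * c ∧ -b0 + b1 + b2 = 2 * c ∧ -d0 + d1 + d2 = 2 * c := by
  have h1 := axis_sq_le (a0 + b0 + d0) (a1 + b1 + d1) (a2 + b2 + d2)
  have h2 : (a0 + b0 + d0) ^ 2 + (a1 + b1 + d1) ^ 2 + (a2 + b2 + d2) ^ 2 ≤ 6 := by nlinarith
  have hS : ((-a0 + a1 + a2) + (-b0 + b1 + b2) + (-d0 + d1 + d2)) ^ 2 ≤ (6 * c) ^ 2 := by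
    have : (-a0 + a1 + a2) + (-b0 + b1 + b2) + (-d0 + d1 + d2) = -(a0 + b0 + d0) + (a1 + b1 + d1) + (a2 + b2 + d2) := by ring
    rw [this]; nlinarith
  have hsum := (abs_le_of_sq_le_sq' hS (by positivity)).2
  exact ⟨by linarith, by linarith, by linarith⟩

end HealCap

/-! ### Vector form -/

/-- The nine slots of the CLOSED LOWER HALF-DOZEN of the model frame (indices of `NearIdentity.slotInt`): the basal hexagon `{0,3,4,7,9,10}` and the
lower triple `{1,5,11}` (axial cubic form `−x₀+x₁+x₂ = 0`, resp. `= −2`); the upper triple is `{2,6,8}`. -/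
def lowerNine : Finset (Fin 12) := {0, 1, 3, 4, 5, 7, 9, 10, 11}

/-- The SIX TIPS: the upper fcc slots `2, 6, 8` and the basal mirrors of the lower slots `1, 5, 11` (the hcp positions above the hexagon). -/
def healTips : Finset (EuclideanSpace ℝ (Fin 3)) :=
  {slotSite 2, slotSite 6, slotSite 8, basalMirror (slotSite 1), basalMirror (slotSite 5), basalMirror (slotSite 11)}

/-- A HEAL-FREE direction: a unit vector at inner product `≤ 1/2` with the nine slots of the closed lower half-dozen. -/
def HealFree (u : EuclideanSpace ℝ (Fin 3)) : Prop :=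
  ‖u‖ = 1 ∧ ∀ k ∈ lowerNine, ⟪u, slotSite k⟫_ℝ ≤ 1 / 2

/-- The tips are module points. -/
theorem healTips_subset_module : (↑healTips : Set (EuclideanSpace ℝ (Fin 3))) ⊆ coaxialModule 1 (Real.sqrt (2 / 3)) := by
  intro t ht
  simp only [healTips, coe_insert, coe_singleton, Set.mem_insert_iff, Set.mem_singleton_iff] at ht
  rcases ht with rfl | rfl | rfl | rfl | rfl | rfl
  · exact slot_mem_module (slotSite_mem 2)
  · exact slot_mem_module (slotSite_mem 6)
  · exact slot_mem_module (slotSite_mem 8)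
  · exact basalMirror_mem_module (slot_mem_module (slotSite_mem 1))
  · exact basalMirror_mem_module (slot_mem_module (slotSite_mem 5))
  · exact basalMirror_mem_module (slot_mem_module (slotSite_mem 11))

/-- `(√2/2)² = 1/2`. -/
private theorem c_sq : (Real.sqrt 2 / 2) ^ 2 = 1 / 2 := by
  have h2 : Real.sqrt 2 ^ 2 = 2 := Real.sq_sqrt (by norm_num)
  nlinarith

/-- The sum of squares of the cubic coordinates of a unit vector is `1`. -/
theorem cubicCoords_sq_sum {u : EuclideanSpace ℝ (Fin 3)} (hu : ‖u‖ = 1) :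
    cubicCoords u 0 ^ 2 + cubicCoords u 1 ^ 2 + cubicCoords u 2 ^ 2 = 1 := by
  have h := norm_sq_eq_cubicCoords u
  rw [hu, one_pow] at h
  simp only [dotProduct, Fin.sum_univ_three] at h
  nlinarith

/-- Inner products in cubic coordinates (three terms). -/
theorem inner_eq_cubicCoords_three (u v : EuclideanSpace ℝ (Fin 3)) :
    ⟪u, v⟫_ℝ = cubicCoords u 0 * cubicCoords v 0 + cubicCoords u 1 * cubicCoords v 1 + cubicCoords u 2 * cubicCoords v 2 := by
  rw [inner_eq_cubicCoords]; simp only [dotProduct, Fin.sum_univ_three]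

/-- **The nine constraints of a heal-free direction in cubic coordinates** (`c = √2/2`). -/
theorem HealFree.constraints {u : EuclideanSpace ℝ (Fin 3)} (h : HealFree u) :
    |cubicCoords u 0 + cubicCoords u 1| ≤ Real.sqrt 2 / 2 ∧ |cubicCoords u 0 + cubicCoords u 2| ≤ Real.sqrt 2 / 2 ∧
    |cubicCoords u 1 - cubicCoords u 2| ≤ Real.sqrt 2 / 2 ∧ cubicCoords u 0 - cubicCoords u 1 ≤ Real.sqrt 2 / 2 ∧
    cubicCoords u 0 - cubicCoords u 2 ≤ Real.sqrt 2 / 2 ∧ -cubicCoords u 1 - cubicCoords u 2 ≤ Real.sqrt 2 / 2 := by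
  have hs : 0 < Real.sqrt 2 := by positivity
  have h2 : Real.sqrt 2 * Real.sqrt 2 = 2 := Real.mul_self_sqrt (by norm_num)
  have key : ∀ k ∈ lowerNine, cubicCoords u 0 * slotInt k 0 + cubicCoords u 1 * slotInt k 1 + cubicCoords u 2 * slotInt k 2 ≤ Real.sqrt 2 / 2 := by
    intro k hk
    have := h.2 k hk
    rw [inner_slotSite_right, div_le_iff₀ hs] at this
    nlinarith
  have e0 := key 0 (by decide); have e1 := key 1 (by decide); have e3 := key 3 (by decide); have e4 := key 4 (by decide)
  have e5 := key 5 (by decide); have e7 := key 7 (by decide); have e9 := key 9 (by decide); have e10 := key 10 (by decide)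
  have e11 := key 11 (by decide)
  simp only [slotInt, Matrix.cons_val_zero, Matrix.cons_val_one, Matrix.cons_val] at e0 e1 e3 e4 e5 e7 e9 e10 e11
  norm_num at e0 e1 e3 e4 e5 e7 e9 e10 e11
  refine ⟨abs_le.2 ⟨by linarith, by linarith⟩, abs_le.2 ⟨by linarith, by linarith⟩, abs_le.2 ⟨by linarith, by linarith⟩, by linarith,
    by linarith, by linarith⟩

/-- **Axial component of a heal-free direction**: `−x₀+x₁+x₂ ≥ √2` (axial cosine `≥ √(2/3)`). -/
theorem HealFree.axis_ge {u : EuclideanSpace ℝ (Fin 3)} (h : HealFree u) :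
    2 * (Real.sqrt 2 / 2) ≤ -cubicCoords u 0 + cubicCoords u 1 + cubicCoords u 2 := by
  obtain ⟨h01, h02, h12, l1, l2, l3⟩ := h.constraints
  exact HealCap.axis_ge c_sq (by positivity) (cubicCoords_sq_sum h.1) h01 h02 h12 l1 l2 l3

/-- A unit direction with axial component exactly `√2` (under the hexagon constraints) is a tip. -/
theorem HealFree.mem_healTips_of_axis {u : EuclideanSpace ℝ (Fin 3)} (h : HealFree u)
    (hT : -cubicCoords u 0 + cubicCoords u 1 + cubicCoords u 2 = 2 * (Real.sqrt 2 / 2)) : u ∈ healTips := by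
  obtain ⟨h01, h02, h12, -, -, -⟩ := h.constraints
  have hs : Real.sqrt 2 ≠ 0 := by positivity
  have h2 : Real.sqrt 2 * Real.sqrt 2 = 2 := Real.mul_self_sqrt (by norm_num)
  have hcases := HealCap.tip c_sq (by positivity) (cubicCoords_sq_sum h.1) h01 h02 h12 hT
  -- the cubic coordinates of the six tips
  have hc2 : cubicCoords (slotSite 2) = ![-(Real.sqrt 2 / 2), Real.sqrt 2 / 2, 0] := by
    rw [cubicCoords_slotSite]; ext i; fin_cases i <;> simp [slotVec, slotInt] <;> field_simp <;> nlinarith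
  have hc6 : cubicCoords (slotSite 6) = ![-(Real.sqrt 2 / 2), 0, Real.sqrt 2 / 2] := by
    rw [cubicCoords_slotSite]; ext i; fin_cases i <;> simp [slotVec, slotInt] <;> field_simp <;> nlinarith
  have hc8 : cubicCoords (slotSite 8) = ![0, Real.sqrt 2 / 2, Real.sqrt 2 / 2] := by
    rw [cubicCoords_slotSite]; ext i; fin_cases i <;> simp [slotVec, slotInt] <;> field_simp <;> nlinarith
  have hm1 : cubicCoords (basalMirror (slotSite 1)) = ![-(Real.sqrt 2 / 2) / 3, Real.sqrt 2 / 2 / 3, 4 * (Real.sqrt 2 / 2) / 3] := by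
    rw [cubicCoords_basalMirror, cubicCoords_slotSite]; ext i; fin_cases i <;> simp [slotVec, slotInt] <;> field_simp <;> nlinarith
  have hm5 : cubicCoords (basalMirror (slotSite 5)) = ![-(Real.sqrt 2 / 2) / 3, 4 * (Real.sqrt 2 / 2) / 3, Real.sqrt 2 / 2 / 3] := by
    rw [cubicCoords_basalMirror, cubicCoords_slotSite]; ext i; fin_cases i <;> simp [slotVec, slotInt] <;> field_simp <;> nlinarith
  have hm11 : cubicCoords (basalMirror (slotSite 11)) = ![-(4 * (Real.sqrt 2 / 2)) / 3, Real.sqrt 2 / 2 / 3, Real.sqrt 2 / 2 / 3] := by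
    rw [cubicCoords_basalMirror, cubicCoords_slotSite]; ext i; fin_cases i <;> simp [slotVec, slotInt] <;> field_simp <;> nlinarith
  have hu : ∀ v : EuclideanSpace ℝ (Fin 3), cubicCoords v = ![cubicCoords u 0, cubicCoords u 1, cubicCoords u 2] → u = v := by
    intro v hv
    apply cubicCoords_injective
    rw [hv]; ext i; fin_cases i <;> rfl
  simp only [healTips, mem_insert, mem_singleton]
  rcases hcases with ⟨e0, e1, e2⟩ | ⟨e0, e1, e2⟩ | ⟨e0, e1, e2⟩ | ⟨e0, e1, e2⟩ | ⟨e0, e1, e2⟩ | ⟨e0, e1, e2⟩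
  · exact Or.inl (hu _ (by rw [hc2, e0, e1, e2]))
  · exact Or.inr (Or.inl (hu _ (by rw [hc6, e0, e1, e2])))
  · exact Or.inr (Or.inr (Or.inl (hu _ (by rw [hc8, e0, e1, e2]))))
  · exact Or.inr (Or.inr (Or.inr (Or.inl (hu _ (by rw [hm1, e0, e1, e2])))))
  · exact Or.inr (Or.inr (Or.inr (Or.inr (Or.inl (hu _ (by rw [hm5, e0, e1, e2]))))))
  · exact Or.inr (Or.inr (Or.inr (Or.inr (Or.inr (hu _ (by rw [hm11, e0, e1, e2]))))))

/-- **HEAL-CAP, vector form**: three heal-free directions pairwise at inner product `≤ 1/2` are three tips. -/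
theorem healFree_three {u₁ u₂ u₃ : EuclideanSpace ℝ (Fin 3)} (h₁ : HealFree u₁) (h₂ : HealFree u₂) (h₃ : HealFree u₃)
    (h12 : ⟪u₁, u₂⟫_ℝ ≤ 1 / 2) (h13 : ⟪u₁, u₃⟫_ℝ ≤ 1 / 2) (h23 : ⟪u₂, u₃⟫_ℝ ≤ 1 / 2) :
    u₁ ∈ healTips ∧ u₂ ∈ healTips ∧ u₃ ∈ healTips := by
  rw [inner_eq_cubicCoords_three] at h12 h13 h23
  obtain ⟨e1, e2, e3⟩ := HealCap.three_axis c_sq (by positivity) (cubicCoords_sq_sum h₁.1) (cubicCoords_sq_sum h₂.1) (cubicCoords_sq_sum h₃.1)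
    h₁.axis_ge h₂.axis_ge h₃.axis_ge h12 h13 h23
  exact ⟨h₁.mem_healTips_of_axis e1, h₂.mem_healTips_of_axis e2, h₃.mem_healTips_of_axis e3⟩

/-! ### Packing form -/

/-- **A further contact of a ball with occupied closed lower half-dozen is a heal-free direction** (transported to the model frame). -/
theorem healFree_of_contact {X : Finset (EuclideanSpace ℝ (Fin 3))} (hX : ∀ p ∈ X, ∀ q ∈ X, p ≠ q → 1 ≤ dist p q)
    (L : EuclideanSpace ℝ (Fin 3) ≃ₗᵢ[ℝ] EuclideanSpace ℝ (Fin 3)) {y x : EuclideanSpace ℝ (Fin 3)}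
    (hocc : ∀ k ∈ lowerNine, y + L (slotSite k) ∈ X) (hx : x ∈ X) (hd : dist y x = 1)
    (hne : ∀ k ∈ lowerNine, x ≠ y + L (slotSite k)) : HealFree (L.symm (x - y)) := by
  have hxy : ‖x - y‖ = 1 := by rw [← dist_eq_norm, dist_comm]; exact hd
  refine ⟨by rw [LinearIsometryEquiv.norm_map]; exact hxy, fun k hk => ?_⟩
  have h1 : ⟪L.symm (x - y), slotSite k⟫_ℝ = ⟪x - y, L (slotSite k)⟫_ℝ := by
    rw [← L.inner_map_map (L.symm (x - y)) (slotSite k), LinearIsometryEquiv.apply_symm_apply]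
  rw [h1]
  refine inner_le_half_of_norm_sub_ge_one hxy (by rw [LinearIsometryEquiv.norm_map]; exact norm_eq_one_of_mem_fccSlots (slotSite_mem k)) ?_
  have : x - y - L (slotSite k) = x - (y + L (slotSite k)) := by abel
  rw [this, ← dist_eq_norm]
  exact hX x hx _ (hocc k hk) (hne k hk)

open scoped Classical in
/-- **HEAL-CAP, packing form**: in a `1`-separated configuration, a ball `y` whose nine positions `y + L(slot)` over the closed lower half-dozen of a frame
`L` are occupied has AT MOST TWO contacts that are neither one of those nine balls nor at one of the six tip positions `y + L(tip)`. -/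
theorem card_offTip_contacts_le_two {X : Finset (EuclideanSpace ℝ (Fin 3))} (hX : ∀ p ∈ X, ∀ q ∈ X, p ≠ q → 1 ≤ dist p q)
    (L : EuclideanSpace ℝ (Fin 3) ≃ₗᵢ[ℝ] EuclideanSpace ℝ (Fin 3)) {y : EuclideanSpace ℝ (Fin 3)}
    (hocc : ∀ k ∈ lowerNine, y + L (slotSite k) ∈ X) :
    (X.filter fun x => dist y x = 1 ∧ (∀ k ∈ lowerNine, x ≠ y + L (slotSite k)) ∧ L.symm (x - y) ∉ healTips).card ≤ 2 := by
  by_contra hlt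
  push Not at hlt
  obtain ⟨a, ha, b, hb, c, hc, hab, hac, hbc⟩ := two_lt_card.1 hlt
  simp only [mem_filter] at ha hb hc
  have hfa := healFree_of_contact hX L hocc ha.1 ha.2.1 ha.2.2.1
  have hfb := healFree_of_contact hX L hocc hb.1 hb.2.1 hb.2.2.1
  have hfc := healFree_of_contact hX L hocc hc.1 hc.2.1 hc.2.2.1
  have hin : ∀ {p q : EuclideanSpace ℝ (Fin 3)}, p ∈ X → q ∈ X → p ≠ q → dist y p = 1 → dist y q = 1 →
      ⟪L.symm (p - y), L.symm (q - y)⟫_ℝ ≤ 1 / 2 := by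
    intro p q hp hq hpq hdp hdq
    rw [L.symm.inner_map_map]
    refine inner_le_half_of_norm_sub_ge_one (by rw [← dist_eq_norm, dist_comm]; exact hdp) (by rw [← dist_eq_norm, dist_comm]; exact hdq) ?_
    have : p - y - (q - y) = p - q := by abel
    rw [this, ← dist_eq_norm]; exact hX p hp q hq hpq
  obtain ⟨hta, -, -⟩ := healFree_three hfa hfb hfc (hin ha.1 hb.1 hab ha.2.1 hb.2.1) (hin ha.1 hc.1 hac ha.2.1 hc.2.1)
    (hin hb.1 hc.1 hbc hb.2.1 hc.2.1)
  exact ha.2.2.2 hta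

/-! ### Degree form (appended): a ball with an occupied closed lower half-dozen and no tip neighbour is deficient -/

open scoped Classical in
/-- **HEAL-CAP, degree form**: in a `1`-separated configuration, a ball `y` whose nine positions `y + L(slot)` over the closed lower half-dozen of a
frame `L` are occupied and NONE of whose six tip positions `y + L(tip)` is occupied has AT MOST ELEVEN contacts — «a facet ball healed only by
incoherent (off-tip) contacts keeps deficiency `≥ 1`» (the sparse-contact half of `MotifFreeEndPools`, simplest instance). -/
theorem card_contacts_le_eleven_of_noTip {X : Finset (EuclideanSpace ℝ (Fin 3))} (hX : ∀ p ∈ X, ∀ q ∈ X, p ≠ q → 1 ≤ dist p q)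
    (L : EuclideanSpace ℝ (Fin 3) ≃ₗᵢ[ℝ] EuclideanSpace ℝ (Fin 3)) {y : EuclideanSpace ℝ (Fin 3)}
    (hocc : ∀ k ∈ lowerNine, y + L (slotSite k) ∈ X) (hnotip : ∀ t ∈ healTips, y + L t ∉ X) :
    (X.filter fun x => dist y x = 1).card ≤ 11 := by
  set N := X.filter fun x => dist y x = 1 with hN
  set N₉ := lowerNine.image fun k => y + L (slotSite k) with hN₉
  set N' := X.filter fun x => dist y x = 1 ∧ (∀ k ∈ lowerNine, x ≠ y + L (slotSite k)) ∧ L.symm (x - y) ∉ healTips with hN'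
  have hsub : N ⊆ N₉ ∪ N' := by
    intro x hx
    rw [mem_filter] at hx
    rw [mem_union]
    by_cases h9 : ∃ k ∈ lowerNine, x = y + L (slotSite k)
    · obtain ⟨k, hk, rfl⟩ := h9
      exact Or.inl (mem_image.2 ⟨k, hk, rfl⟩)
    · push Not at h9
      refine Or.inr (mem_filter.2 ⟨hx.1, hx.2, h9, fun ht => ?_⟩)
      have hx' : y + L (L.symm (x - y)) = x := by rw [LinearIsometryEquiv.apply_symm_apply]; abel
      refine hnotip _ ht ?_
      rw [hx']; exact hx.1
  have h9card : N₉.card ≤ 9 := card_image_le.trans (by decide)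
  have h2 := card_offTip_contacts_le_two hX L hocc
  calc N.card ≤ (N₉ ∪ N').card := card_le_card hsub
    _ ≤ N₉.card + N'.card := card_union_le _ _
    _ ≤ 9 + 2 := Nat.add_le_add h9card h2

end TailResidue

end Summit.Ventures.Crystal3D.Theorems

end
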